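import Mathlib
import HarnessLib
import Summits.ValiantsHypothesis.ValiantsHypothesis.Theses.MonotoneRestoration
import Literature.Computability.AlgebraicComplexity.ArithCircuit
import Literature.Computability.AlgebraicComplexity.ArithCircuitProofs
import Literature.Computability.AlgebraicComplexity.MonotoneStructure
import Literature.Computability.AlgebraicComplexity.PermanentIrreducible
import Literature.ModelTheory.FiniteModelTheory.CkEquiv
import Summits.ValiantsHypothesis.ValiantsHypothesis.Theorems.MonotoneRestorationMonotoneRestorationQPCosetCount
import Summits.ValiantsHypothesis.ValiantsHypothesis.Theorems.MonotoneRestorationMonotoneRestorationQPSymmetricLB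
import Summits.ValiantsHypothesis.ValiantsHypothesis.Theorems.MonotoneRestorationMonotoneRestorationQPSupportSymmetrisation
import Summits.ValiantsHypothesis.ValiantsHypothesis.Theorems.MonotoneRestorationMonotoneRestorationQPSparseRegime
import Summits.ValiantsHypothesis.ValiantsHypothesis.Theorems.MonotoneRestorationMonotoneRestorationQPBeta
import Literature.Computability.AlgebraicComplexity.SymmetricArithCircuit
import Literature.Computability.AlgebraicComplexity.DawarWilsenach2025Proofs
import Literature.GroupTheory.PermutationGroups.SmallIndexSubgroups
import Summits.ValiantsHypothesis.ValiantsHypothesis.Theorems.MonotoneRestorationQP.Negative.LoadBearing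
import Summits.ValiantsHypothesis.ValiantsHypothesis.Theorems.MonotoneRestorationMonotoneRestorationQPPermSupportCount

/-! TTRL-lite variant V18923 of stmt-ValiantsHypothesis-15886 -/

-- `ValiantsHypothesis.ValiantsHypothesis`: the D-0017 layout repeats the problem name in the path.
set_option linter.dupNamespace false

namespace Summit.ValiantsHypothesis.ValiantsHypothesis.Theorems

open Summit.ValiantsHypothesis.ValiantsHypothesis.Theses.MonotoneRestoration
open Literature.Computability.AlgebraicComplexity

/-- TTRL-lite variant V18923 (lemma proposal) of `stub_mulGate_children_extend`: a `×`-gate `P`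
factors through any one of its children `h` — `eval P = eval h * ∏_{x ∈ children P \ {h}} eval x`.
Immediate from `LabelledArithCircuit.eval_of_label_mul` and `Finset.mul_prod_erase`; this is the
first `have` of the proof of the parent stub. [folklore] -/
theorem stub_mulGate_children_extend_var18923 :
    ∀ (n : ℕ) (G : Type) [DecidableEq G] (C : LabelledArithCircuit NNReal (Fin n × Fin n) Unit G)
      (P h : G), C.label P = .mul → h ∈ C.children P →
      C.eval P = C.eval h * ∏ x ∈ (C.children P).erase h, C.eval x := by
  intro n G _ C P h hP hh
  rw [C.eval_of_label_mul hP, Finset.mul_prod_erase (C.children P) (fun x => C.eval x) hh]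

end Summit.ValiantsHypothesis.ValiantsHypothesis.Theorems
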